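import Mathlib.GroupTheory.GroupAction.Quotient
import Mathlib.GroupTheory.QuotientGroup.Basic
import Mathlib.SetTheory.Cardinal.Finite

/-!
# Transport of fixed points on coset spaces along a group isomorphism

For a group isomorphism `e : G ≃* G'` and a subgroup `K ≤ G`, the coset spaces `G ⧸ K` and
`G' ⧸ e(K)` are identified `e`-equivariantly (`⟦a⟧ ↦ ⟦e a⟧`); hence for every `g : G` the fixed
points of `g` on `G ⧸ K` and of `e g` on `G' ⧸ e(K)` are in bijection and have the same cardinality.
This is the pure group-theoretic half of «orbital transport along a frame»: combined with the
fixed-point formula for unit orbital integrals (`Φ(γ, 1_K) = #Fix(γ, G ⧸ K)`) it moves a unit orbital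
integral along an isomorphism of `p`-adic groups carrying one hyperspecial subgroup onto another
(Flicker's model `U(J)(E∕F) ⊃ K = U(J)(R_E)` versus the group of record).  Theorems only.
[cite: Flicker1998UnitaryFL, §3 p. 80; Rogawski1990, §4.9 p. 55]
-/

namespace Literature.GroupTheory.Index

open MulAction

variable {G G' : Type*} [Group G] [Group G']

/-- The relation transport behind `⟦a⟧ ↦ ⟦e a⟧`: `a⁻¹ b ∈ K ↔ (e a)⁻¹ (e b) ∈ e(K)`.
[cite: Flicker1998UnitaryFL, §3 p. 80] -/
theorem leftRel_iff_leftRel_map (e : G ≃* G') (K : Subgroup G) (a b : G) :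
    QuotientGroup.leftRel K a b ↔ QuotientGroup.leftRel (K.map e.toMonoidHom) (e a) (e b) := by
  rw [QuotientGroup.leftRel_apply, QuotientGroup.leftRel_apply]
  constructor
  · intro h
    exact ⟨a⁻¹ * b, h, by simp⟩
  · rintro ⟨x, hx, hxe⟩
    have : x = a⁻¹ * b := e.injective (by simpa using hxe)
    simpa [this] using hx

/-- **An `e`-equivariant identification of coset spaces exists**: there is a bijection
`φ : G ⧸ K ≃ G' ⧸ e(K)` with `φ ⟦a⟧ = ⟦e a⟧`, hence `φ (g • q) = e g • φ q`.
[cite: Flicker1998UnitaryFL, §3 p. 80] -/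
theorem exists_equiv_quotient_map (e : G ≃* G') (K : Subgroup G) :
    ∃ φ : G ⧸ K ≃ G' ⧸ K.map e.toMonoidHom,
      (∀ a : G, φ (QuotientGroup.mk a) = QuotientGroup.mk (e a)) ∧
      ∀ (g : G) (q : G ⧸ K), φ (g • q) = e g • φ q := by
  refine ⟨Quotient.congr e.toEquiv fun a b => leftRel_iff_leftRel_map e K a b, fun a => rfl, ?_⟩
  intro g q
  induction q using QuotientGroup.induction_on with
  | H a =>
    rw [MulAction.Quotient.smul_coe, smul_eq_mul]
    change QuotientGroup.mk (e (g * a)) = e g • (QuotientGroup.mk (e a) : G' ⧸ K.map e.toMonoidHom)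
    rw [MulAction.Quotient.smul_coe, smul_eq_mul, map_mul]

/-- **Fixed-point counts are transported along a group isomorphism**:
`#Fix(g, G ⧸ K) = #Fix(e g, G' ⧸ e(K))`. [cite: Flicker1998UnitaryFL, §3 p. 80; Rogawski1990, §4.9 p. 55] -/
theorem natCard_fixedBy_quotient_congr (e : G ≃* G') (K : Subgroup G) (g : G) :
    Nat.card (fixedBy (G ⧸ K) g) = Nat.card (fixedBy (G' ⧸ K.map e.toMonoidHom) (e g)) := by
  obtain ⟨φ, -, hφ⟩ := exists_equiv_quotient_map e K
  refine Nat.card_congr (φ.subtypeEquiv fun q => ?_)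
  rw [mem_fixedBy, mem_fixedBy, ← hφ]
  exact φ.injective.eq_iff.symm

/-- Same, with the image subgroup named: if `e` carries `K` onto `K'` then
`#Fix(g, G ⧸ K) = #Fix(e g, G' ⧸ K')`. [cite: Flicker1998UnitaryFL, §3 p. 80; Rogawski1990, §4.9 p. 55] -/
theorem natCard_fixedBy_quotient_congr_of_map_eq (e : G ≃* G') (K : Subgroup G) (K' : Subgroup G')
    (hK : K.map e.toMonoidHom = K') (g : G) :
    Nat.card (fixedBy (G ⧸ K) g) = Nat.card (fixedBy (G' ⧸ K') (e g)) := by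
  subst hK
  exact natCard_fixedBy_quotient_congr e K g

/-- Comap form: if `K = e⁻¹(K')` (equivalently `e(K) = K'`) then `#Fix(g, G ⧸ K) = #Fix(e g, G' ⧸ K')`.
[cite: Flicker1998UnitaryFL, §3 p. 80] -/
theorem natCard_fixedBy_quotient_congr_of_comap_eq (e : G ≃* G') (K : Subgroup G) (K' : Subgroup G')
    (hK : K'.comap e.toMonoidHom = K) (g : G) :
    Nat.card (fixedBy (G ⧸ K) g) = Nat.card (fixedBy (G' ⧸ K') (e g)) := by
  refine natCard_fixedBy_quotient_congr_of_map_eq e K K' ?_ g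
  subst hK
  exact Subgroup.map_comap_eq_self_of_surjective e.surjective K'

/-- Inner version: conjugating the subgroup inside one group,
`#Fix(g, G ⧸ K) = #Fix(x g x⁻¹, G ⧸ xKx⁻¹)`. [cite: Flicker1998UnitaryFL, §3 p. 80; Rogawski1990, §4.9 p. 55] -/
theorem natCard_fixedBy_quotient_conj (K : Subgroup G) (x g : G) :
    Nat.card (fixedBy (G ⧸ K) g) =
      Nat.card (fixedBy (G ⧸ K.map (MulAut.conj x).toMonoidHom) (x * g * x⁻¹)) := by
  simpa using natCard_fixedBy_quotient_congr (MulAut.conj x) K g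

/-- Fixed-point counts on one coset space are conjugation-invariant in the acting element:
`#Fix(g, G ⧸ K) = #Fix(x g x⁻¹, G ⧸ K)` (translate the fixed cosets by `x`).
[cite: Rogawski1990, §4.9 p. 55] -/
theorem natCard_fixedBy_quotient_conj_self (K : Subgroup G) (x g : G) :
    Nat.card (fixedBy (G ⧸ K) g) = Nat.card (fixedBy (G ⧸ K) (x * g * x⁻¹)) := by
  refine Nat.card_congr ((MulAction.toPerm x : Equiv.Perm (G ⧸ K)).subtypeEquiv fun q => ?_)
  simp only [mem_fixedBy, MulAction.toPerm_apply]
  constructor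
  · intro h
    rw [mul_smul, mul_smul, inv_smul_smul, h]
  · intro h
    have := congr_arg (fun q' => x⁻¹ • q') h
    simpa [mul_smul] using this

end Literature.GroupTheory.Index
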